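import Mathlib
import Summits.ValiantsHypothesis.ValiantsHypothesis.Theses.NewtonUnitEquations

/-!
# Line `annihilator-product-functional` — checked skeleton for crux `DissociatedFixedK`
(stmt-ValiantsHypothesis-5907, route NewtonUnitEquations, rank 4)

Crux (FIXED, never restated):
`Summit.ValiantsHypothesis.ValiantsHypothesis.Theses.NewtonUnitEquations.DissociatedFixedK` =
`∀ k, ∃ C, ∀ m t (A : Fin m → Finset (Fin 2 →₀ ℕ)) (f : Fin k → Fin m → MvPolynomial (Fin 2) ℂ),
(∀ j, #A j ≤ t) → (∀ i j, supp f i j ⊆ A j) → (sum map injective on Π_j A j) →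
#extremePoints (conv (emb '' supp (Σ_i Π_j f i j))) ≤ (m t + 2) ^ C`.

## The line (idea card `Ideas/annihilator-product-functional.md`, triage r1: pass ×3)

Write `c i j e = coeff e (f i j)` and `T(a) = Σ_i Π_j c i j (a j)` for a grid word `a ∈ Π_j A j`.

* `stub_exposedWord`  (blueprint steps 1–2: dictionary + strict exposure).  Every vertex `p` of the
  Newton polygon is `emb (Σ_j a_j)` for a grid word `a` with `T(a) ≠ 0`, and some continuous linear
  functional `l` on `ℝ²` makes `a` the STRICT `l`-top among all surviving words (`T ≠ 0`).
  [dissociation and `supp ⊆ A` are used exactly here; no genericity of `l` is required anywhere]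
* `stub_thicknessFit`  (blueprint step 3, THIS LINE'S LEVER — the annihilating product functional;
  PROVED in FullProof §0–§1, registered as a stub for landing).  If `a` is the strict `l`-top survivor and `b` is any word that is letterwise
  `l`-above `a` and alive in every product alive at `a`, then `b` and `a` differ in `< k` coordinates.
  Proof: restrict `T` to the sub-cube `Π_{j : b j ≠ a j} {a j, b j}` (all other cube words are `l`-≥ `a`,
  `≠ a`, hence cancelled) and apply `thickness_of_annihilator` (PROVED, induction- and division-free):
  one product functional `Λ_λ` with `λ_j = (0,1)` on a dead coordinate per dead product and
  `λ_{ι i} = (φ_i(1), -φ_i(0))` along an injection of the alive products kills every rank-one term but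
  not `T|_cube = T(a)·δ_a`.  Same statement shape as the LANDED
  `Theorems/DissociatedFixedK/Negative/CubeLemma.lean` `mixed_cube_lemma` (p73482).
* `stub_topTupleCount`  (blueprint step 4: counting).  For letter sets `S j ⊆ ℕ²` with `#S j ≤ t`, the
  tuples `b ∈ Π_j S j` that are, for SOME functional `l`, coordinatewise maximal for the lexicographic
  key `(l (emb e), e 0, e 1)` number `≤ 4 (m t)² + 7` (comparison patterns of `l` on the `≤ m t`
  letters; = Disproof.lean v3 §E3/§E4 `ncard_range_topTuple_le`, or the keyed sweep of
  `SketchIdeator2.sweep_boxTop_ncard_le`).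
* `DissociatedFixedK_of : DissociatedFixedK` (the skeleton theorem; no `sorry` of its own — it invokes the
  two stubs by name and everything else is proved): the assembly.  For a vertex `p` take `(a, l)` from
  `stub_exposedWord`, the alive pattern `I = {i : ∀ j, c i j (a j) ≠ 0}`, the alive box
  `C I j = {e ∈ A j : ∀ i ∈ I, c i j e ≠ 0} ∋ a j`, and `b j` a lex-key-maximal letter of `C I j`;
  `stub_thicknessFit` gives `#{j : b j ≠ a j} < k`, so `a` is `b` overwritten by `< k` (coordinate, letter)
  pairs.  Encoding `p ↦ (I, slot list of the overwritten pairs, b)` covers the vertex set by a finset of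
  size `≤ 2^k · (m t + 1)^k · (4 (m t)² + 7) ≤ (m t + 2)^(2k+3)`, i.e. `C = 2 k + 3`.

## Disproof.lean (v3) obligations honoured
`dissociatedFixedK_false_without_card`: `#A j ≤ t` enters `stub_topTupleCount` (`#S j ≤ t`) and the
slot count `(1 + Σ_j #A j)^k ≤ (m t + 1)^k`.  `…_false_without_supp`: `supp f i j ⊆ A j` enters
`stub_exposedWord` (dictionary).  Dissociation: only in `stub_exposedWord` (as Disproof §B predicts).
§A' sharpness: `stub_thicknessFit` proves exactly `< k` (attained).  §C (`¬ UniformC`): `C = 2k + 3`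
grows with `k`.  No stub is an instance of a landed Negative lemma's negation (`Negative/CubeLemma.lean`
is the same-shape cross-check of `stub_thicknessFit` — imported in the scratch check, not here, to keep this
file's farm check independent of that module's build; `Negative/LoadBearing.lean`'s
`¬Without{Card,Supp}` concern deleted hypotheses only).

Namespace private to this line.  RESHAPED by the lead (line-stmt-ValiantsHypothesis-5907-0, 2026-08-16):
`sorry` occurs ONLY in the FOUR `stub_*` theorems `stub_exposedWord`, `stub_cmpPatCount` (sub-goal of the next), `stub_thicknessFit` (the former
in-skeleton `thickness_fit`, promoted to a registered stub so that it lands as its own ≤ 400-line Theorems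
file), `stub_topTupleCount`; all three have machine-checked proofs (`FullProof-annihilator-product-functional.lean`,
rc 0, 0 sorry, standard axioms), being landed as
`Theorems/NewtonUnitEquationsDissociatedFixedK{ExposedWord,Thickness,Sweep,TopTupleCount}.lean` (`--supports`)
and `Theorems/NewtonUnitEquationsDissociatedFixedK.lean` (this assembly, `--workitem`).
-/

set_option linter.unusedVariables false
set_option linter.dupNamespace false

namespace Summit.ValiantsHypothesis.ValiantsHypothesis.Cruxes.DissociatedFixedK.AnnihilatorProductFunctional

open scoped BigOperators Classical

noncomputable section

/-! ## §1  Thickness at a vertex — the lever fitted to the crux's data (registered stub) -/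

/-- **stub_thicknessFit** — blueprint step 3 by the annihilating product functional (THIS LINE'S LEVER;
machine-checked proof in `FullProof-annihilator-product-functional.lean` §0–§1, to be landed as
`Theorems/NewtonUnitEquationsDissociatedFixedKThickness.lean`).  `c i j e` is an abstract coefficient
tensor (for the crux: `coeff e (f i j)`), `a` the strict `l`-top surviving word, `b` a word of the frame
that is letterwise `l`-above `a` (`hba`) and alive in every coordinate for every product alive at `a`
(`hbI`).  Then `b` and `a` differ in `< k` places.  Proof: on the sub-cube
`Π_{j ∈ J} {a j, b j} × Π_{j ∉ J} {a j}`, `J = {j : b j ≠ a j}`, every word other than `a` is `l`-≥ `a`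
(additivity of `l ∘ emb` over letters, `hba`) and `≠ a`, hence has `T = 0` by `htop`; with
`x i = Π_{j∉J} c i j (a j)`, `φ i j true = c i j (a j)`, `φ i j false = c i j (b j)` the trichotomy of
`thickness_of_annihilator` holds (`hbI` for alive terms; a term dead at `a` is dead inside `J` or has
`x i = 0`), and one annihilating product functional gives `card J < k`.  No dissociation and no
genericity of `l` are needed.  [same statement shape as the landed `Negative.CubeLemma.mixed_cube_lemma`,
p73482] -/
theorem stub_thicknessFit {k m : ℕ} (A : Fin m → Finset (Fin 2 →₀ ℕ))
    (c : Fin k → Fin m → (Fin 2 →₀ ℕ) → ℂ) (l : (Fin 2 → ℝ) →L[ℝ] ℝ)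
    (a b : Fin m → (Fin 2 →₀ ℕ)) (ha : ∀ j, a j ∈ A j) (hb : ∀ j, b j ∈ A j)
    (hTa : (∑ i, ∏ j, c i j (a j)) ≠ 0)
    (htop : ∀ a' : Fin m → (Fin 2 →₀ ℕ), (∀ j, a' j ∈ A j) → a' ≠ a →
      (∑ i, ∏ j, c i j (a' j)) ≠ 0 →
      l (fun i : Fin 2 => (((∑ j, a' j) i : ℕ) : ℝ)) < l (fun i : Fin 2 => (((∑ j, a j) i : ℕ) : ℝ)))
    (hbI : ∀ i, (∀ j, c i j (a j) ≠ 0) → ∀ j, c i j (b j) ≠ 0)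
    (hba : ∀ j, l (fun i : Fin 2 => (((a j) i : ℕ) : ℝ)) ≤ l (fun i : Fin 2 => (((b j) i : ℕ) : ℝ))) :
    (Finset.univ.filter fun j => b j ≠ a j).card < k := by
  sorry


/-! ## §2  The registered stubs `stub_exposedWord`, `stub_cmpPatCount`, `stub_topTupleCount` -/

/-- **stub_exposedWord** — blueprint steps 1–2 (dictionary + strict exposure).  Every vertex of the
Newton polygon of `Σ_i Π_j f_ij` on a dissociated frame is `emb (Σ_j a_j)` for a grid word `a` with
nonzero tensor value, which is the STRICT maximiser, among all surviving grid words, of some continuous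
linear functional `l` on `ℝ²`.  [Hahn–Banach against the hull of the other (finitely many) support
points = Disproof.lean v3 §E0 `exists_strict_sep_of_mem_extremePoints_convexHull`; coefficient/support
formula = §E1 `coeff_sum_prod_of_dissociated`, `exists_word_of_mem_support` (also SketchIdeator3
`coeff_sum_prod_of_injective`, `support_sum_prod_subset`); `emb` is injective.] -/
theorem stub_exposedWord {k m : ℕ} (A : Fin m → Finset (Fin 2 →₀ ℕ))
    (f : Fin k → Fin m → MvPolynomial (Fin 2) ℂ)
    (hf : ∀ i j, (f i j).support ⊆ A j)
    (hinj : ∀ a b : Fin m → (Fin 2 →₀ ℕ), (∀ j, a j ∈ A j) → (∀ j, b j ∈ A j) →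
      ∑ j, a j = ∑ j, b j → a = b)
    (p : Fin 2 → ℝ)
    (hp : p ∈ Set.extremePoints ℝ (convexHull ℝ
      ((fun e : Fin 2 →₀ ℕ => fun i : Fin 2 => ((e i : ℕ) : ℝ)) ''
        ((∑ i, ∏ j, f i j).support : Set (Fin 2 →₀ ℕ))))) :
    ∃ (a : Fin m → (Fin 2 →₀ ℕ)) (l : (Fin 2 → ℝ) →L[ℝ] ℝ),
      (∀ j, a j ∈ A j) ∧
      p = (fun i : Fin 2 => (((∑ j, a j) i : ℕ) : ℝ)) ∧
      (∑ i, ∏ j, (f i j).coeff (a j)) ≠ 0 ∧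
      ∀ a' : Fin m → (Fin 2 →₀ ℕ), (∀ j, a' j ∈ A j) → a' ≠ a →
        (∑ i, ∏ j, (f i j).coeff (a' j)) ≠ 0 →
        l (fun i : Fin 2 => (((∑ j, a' j) i : ℕ) : ℝ)) < l (fun i : Fin 2 => (((∑ j, a j) i : ℕ) : ℝ)) := by
  sorry

/-- **stub_cmpPatCount** — registered SUB-GOAL of `stub_topTupleCount` (reshaped by the lead so that the
planar counting kit lands as its own ≤ 400-line Theorems file carrying a registered stub): as `l` ranges
over ALL continuous linear functionals on `ℝ²`, the comparison pattern `(p, q) ↦ [l p < l q]` on a finite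
`P ⊂ ℝ²` takes at most `4 |P|² + 7` values (one-parameter sweeps `(±1, s)`, `(0, ±1)`, `0` + root
counting of the `≤ |P|²` affine functions `s ↦ (q₀ - p₀) ± s (q₁ - p₁)`; Disproof.lean v3 §E2–§E3
`ncard_range_cmpPat_le`, CHECKED).  Not used by `DissociatedFixedK_of` directly: it is the engine of the
landed proof of `stub_topTupleCount` (§E4: the lex-top tuple factors through the comparison pattern). -/
theorem stub_cmpPatCount (P : Finset (Fin 2 → ℝ)) :
    (Set.range (fun l : (Fin 2 → ℝ) →L[ℝ] ℝ => fun pq : ↥P × ↥P => decide (l pq.1 < l pq.2))).ncard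
      ≤ 4 * (P.card * P.card) + 7 := by
  sorry

/-- **stub_topTupleCount** — blueprint step 4 (counting the box tops).  For letter sets `S j` with
`#S j ≤ t`, the tuples `b ∈ Π_j S j` which, for SOME continuous linear functional `l`, are coordinatewise
maximal for the lexicographic key `e ↦ (l (emb e), e 0, e 1)` number at most `4 (m t)² + 7`.
[The key-top tuple depends on `l` only through the comparison pattern of `l` on the `≤ m t` letters,
and an arbitrary functional on a finite planar set `P` has `≤ 4|P|² + 7` comparison patterns:
Disproof.lean v3 §E3 `ncard_range_cmpPat_le` + §E4 `lexTop_eq_of_cmpPat_eq`, `ncard_range_topTuple_le`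
(all CHECKED there); alternative: the keyed slope sweep, SketchIdeator2 `sweep_boxTop_ncard_le`
(`≤ 2(m(t-1)+1)` for functionals with nonzero second coordinate).] -/
theorem stub_topTupleCount (m t : ℕ) (S : Fin m → Finset (Fin 2 →₀ ℕ)) (hS : ∀ j, (S j).card ≤ t) :
    ((Fintype.piFinset S).filter fun b : Fin m → (Fin 2 →₀ ℕ) =>
        ∃ l : (Fin 2 → ℝ) →L[ℝ] ℝ, ∀ j, ∀ e ∈ S j,
          (toLex (l (fun i : Fin 2 => ((e i : ℕ) : ℝ)), toLex (e 0, e 1)) : Lex (ℝ × Lex (ℕ × ℕ)))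
            ≤ toLex (l (fun i : Fin 2 => (((b j) i : ℕ) : ℝ)), toLex ((b j) 0, (b j) 1))).card
      ≤ 4 * (m * t) ^ 2 + 7 := by
  sorry


/-! ## §3  Encoding helpers for the assembly (PROVED) -/

/-- Decode: the letter for coordinate `j` is read off the slot list `L` (any slot carrying `j`),
defaulting to `b j` when no slot carries `j`. -/
def word {k m : ℕ} (L : Fin k → Option (Fin m × (Fin 2 →₀ ℕ)))
    (b : Fin m → (Fin 2 →₀ ℕ)) (j : Fin m) : Fin 2 →₀ ℕ :=
  if h : ∃ s : Fin k, ∃ e : Fin 2 →₀ ℕ, L s = some (j, e) then (Classical.choose_spec h).choose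
  else b j

theorem word_eq {k m : ℕ} {L : Fin k → Option (Fin m × (Fin 2 →₀ ℕ))}
    {b a : Fin m → (Fin 2 →₀ ℕ)} {j : Fin m}
    (hfaith : ∀ (s : Fin k) (e : Fin 2 →₀ ℕ), L s = some (j, e) → e = a j)
    (hcov : (∃ s : Fin k, ∃ e : Fin 2 →₀ ℕ, L s = some (j, e)) ∨ b j = a j) :
    word L b j = a j := by
  unfold word
  split_ifs with h
  · exact hfaith _ _ (Classical.choose_spec h).choose_spec
  · rcases hcov with h' | h'
    · exact absurd h' h
    · exact h'

/-- Encode: the canonical slot list of a coordinate set `J` (in increasing order) with the letters of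
`a`, padded with `none`. -/
def canon {k m : ℕ} (J : Finset (Fin m)) (a : Fin m → (Fin 2 →₀ ℕ)) (s : Fin k) :
    Option (Fin m × (Fin 2 →₀ ℕ)) :=
  if h : (s : ℕ) < J.card then
    some (J.orderEmbOfFin rfl ⟨s, h⟩, a (J.orderEmbOfFin rfl ⟨s, h⟩))
  else none

theorem canon_apply_of_eq {k m : ℕ} (J : Finset (Fin m)) (a : Fin m → (Fin 2 →₀ ℕ)) (s : Fin k)
    (r : Fin J.card) (hs : (s : ℕ) = r) :
    canon J a s = some (J.orderEmbOfFin rfl r, a (J.orderEmbOfFin rfl r)) := by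
  have h : (s : ℕ) < J.card := hs ▸ r.2
  unfold canon
  rw [dif_pos h]
  have e1 : (⟨(s : ℕ), h⟩ : Fin J.card) = r := Fin.ext hs
  rw [e1]

theorem canon_faithful {k m : ℕ} {J : Finset (Fin m)} {a : Fin m → (Fin 2 →₀ ℕ)} {s : Fin k}
    {j : Fin m} {e : Fin 2 →₀ ℕ} (hs : canon J a s = some (j, e)) : j ∈ J ∧ e = a j := by
  unfold canon at hs
  by_cases h : (s : ℕ) < J.card
  · rw [dif_pos h] at hs
    simp only [Option.some.injEq, Prod.mk.injEq] at hs
    obtain ⟨hj, he⟩ := hs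
    subst hj
    exact ⟨Finset.orderEmbOfFin_mem _ _ _, he.symm⟩
  · rw [dif_neg h] at hs
    exact absurd hs (by simp)

theorem canon_covers {k m : ℕ} {J : Finset (Fin m)} {a : Fin m → (Fin 2 →₀ ℕ)} {j : Fin m}
    (hj : j ∈ J) (hJ : J.card ≤ k) :
    ∃ s : Fin k, ∃ e : Fin 2 →₀ ℕ, canon J a s = some (j, e) := by
  have hr : j ∈ Set.range (J.orderEmbOfFin rfl) := by
    rw [Finset.range_orderEmbOfFin, Finset.mem_coe]
    exact hj
  obtain ⟨r, hr⟩ := hr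
  refine ⟨⟨r, lt_of_lt_of_le r.2 hJ⟩, a j, ?_⟩
  rw [canon_apply_of_eq J a ⟨r, lt_of_lt_of_le r.2 hJ⟩ r rfl, hr]

theorem canon_mem {k m : ℕ} (A : Fin m → Finset (Fin 2 →₀ ℕ)) {J : Finset (Fin m)}
    {a : Fin m → (Fin 2 →₀ ℕ)} (ha : ∀ j, a j ∈ A j) (s : Fin k) :
    canon J a s ∈ Finset.insertNone (Finset.univ.biUnion fun j => (A j).image (Prod.mk j)) := by
  unfold canon
  by_cases h : (s : ℕ) < J.card
  · rw [dif_pos h, Finset.some_mem_insertNone]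
    refine Finset.mem_biUnion.2 ⟨J.orderEmbOfFin rfl ⟨s, h⟩, Finset.mem_univ _, ?_⟩
    exact Finset.mem_image.2 ⟨_, ha _, rfl⟩
  · rw [dif_neg h]
    exact Finset.none_mem_insertNone

/-- The final arithmetic: `2^k (mt+1)^k (4(mt)²+7) ≤ (mt+2)^(2k+3)`. -/
theorem count_arith (k m t : ℕ) :
    2 ^ k * ((m * t + 1) ^ k * (4 * (m * t) ^ 2 + 7)) ≤ (m * t + 2) ^ (2 * k + 3) := by
  have h2k : 2 ^ k ≤ (m * t + 2) ^ k := Nat.pow_le_pow_left (by omega) k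
  have hmk : (m * t + 1) ^ k ≤ (m * t + 2) ^ k := Nat.pow_le_pow_left (by omega) k
  have hlast : 4 * (m * t) ^ 2 + 7 ≤ (m * t + 2) ^ 3 := by
    have e : (m * t + 2) ^ 3 = (m * t) ^ 3 + 6 * (m * t) ^ 2 + 12 * (m * t) + 8 := by ring
    rw [e]
    have h0 : 0 ≤ (m * t) ^ 3 := Nat.zero_le _
    omega
  calc 2 ^ k * ((m * t + 1) ^ k * (4 * (m * t) ^ 2 + 7))
      ≤ (m * t + 2) ^ k * ((m * t + 2) ^ k * (m * t + 2) ^ 3) :=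
        Nat.mul_le_mul h2k (Nat.mul_le_mul hmk hlast)
    _ = (m * t + 2) ^ (2 * k + 3) := by ring


/-! ## §4  The skeleton theorem: the crux BY NAME from the three stubs (no `sorry` of its own) -/

/-- **Assembly / skeleton theorem.**  The crux BY NAME from the three registered stubs (used as the
named theorems `stub_exposedWord`, `stub_thicknessFit`, `stub_topTupleCount` — the gate's by-name policy:
no `Prop` hypotheses), with `C = 2k + 3`.  This proof uses nothing about the stubs except their
statements; with the stubs as explicit hypotheses instead (scratch `composition-hyps.lean`, attached as
evidence) the very same proof has axioms {propext, Classical.choice, Quot.sound}. -/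
theorem DissociatedFixedK_of :
    Summit.ValiantsHypothesis.ValiantsHypothesis.Theses.NewtonUnitEquations.DissociatedFixedK := by
  intro k
  refine ⟨2 * k + 3, ?_⟩
  intro m t A f hA hf hinj
  -- the coefficient tensor and the alive boxes `C I j`
  set c : Fin k → Fin m → (Fin 2 →₀ ℕ) → ℂ := fun i j e => (f i j).coeff e with hc
  set C : Finset (Fin k) → Fin m → Finset (Fin 2 →₀ ℕ) := fun I j =>
    (A j).filter fun e => ∀ i ∈ I, c i j e ≠ 0 with hC
  have hCA : ∀ I j, C I j ⊆ A j := fun I j => Finset.filter_subset _ _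
  have hCcard : ∀ I j, (C I j).card ≤ t := fun I j => (Finset.card_le_card (hCA I j)).trans (hA j)
  -- the box tops of pattern `I` (over all functionals), counted by `stub_topTupleCount`
  set BT : Finset (Fin k) → Finset (Fin m → (Fin 2 →₀ ℕ)) := fun I =>
    (Fintype.piFinset (C I)).filter fun b : Fin m → (Fin 2 →₀ ℕ) =>
      ∃ l : (Fin 2 → ℝ) →L[ℝ] ℝ, ∀ j, ∀ e ∈ C I j,
        (toLex (l (fun i : Fin 2 => ((e i : ℕ) : ℝ)), toLex (e 0, e 1)) : Lex (ℝ × Lex (ℕ × ℕ)))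
          ≤ toLex (l (fun i : Fin 2 => (((b j) i : ℕ) : ℝ)), toLex ((b j) 0, (b j) 1)) with hBT
  have hBTcard : ∀ I, (BT I).card ≤ 4 * (m * t) ^ 2 + 7 := fun I =>
    stub_topTupleCount m t (C I) (hCcard I)
  -- the letters and the slot lists
  set LET : Finset (Fin m × (Fin 2 →₀ ℕ)) :=
    Finset.univ.biUnion fun j => (A j).image (Prod.mk j) with hLET
  set LST : Finset (Fin k → Option (Fin m × (Fin 2 →₀ ℕ))) :=
    Fintype.piFinset fun _ => Finset.insertNone LET with hLST
  have hLETcard : LET.card ≤ m * t := by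
    calc LET.card ≤ ∑ j, ((A j).image (Prod.mk j)).card := Finset.card_biUnion_le
      _ ≤ ∑ _j : Fin m, t := Finset.sum_le_sum fun j _ => Finset.card_image_le.trans (hA j)
      _ = m * t := by simp
  have hLSTcard : LST.card ≤ (m * t + 1) ^ k := by
    have e : LST.card = (LET.card + 1) ^ k := by
      simp only [hLST, Fintype.card_piFinset, Finset.card_insertNone, Finset.prod_const,
        Finset.card_univ, Fintype.card_fin]
    rw [e]
    exact Nat.pow_le_pow_left (by omega) k
  -- the covering finset
  set U : Finset (Fin 2 → ℝ) := (Finset.univ : Finset (Finset (Fin k))).biUnion fun I =>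
    LST.biUnion fun L => (BT I).image fun b =>
      (fun i : Fin 2 => (((∑ j, word L b j) i : ℕ) : ℝ)) with hU
  have hUcard : U.card ≤ 2 ^ k * ((m * t + 1) ^ k * (4 * (m * t) ^ 2 + 7)) := by
    calc U.card
        ≤ ∑ I : Finset (Fin k), (LST.biUnion fun L => (BT I).image fun b =>
            (fun i : Fin 2 => (((∑ j, word L b j) i : ℕ) : ℝ))).card := Finset.card_biUnion_le
      _ ≤ ∑ I : Finset (Fin k), ∑ L ∈ LST, ((BT I).image fun b =>
            (fun i : Fin 2 => (((∑ j, word L b j) i : ℕ) : ℝ))).card :=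
          Finset.sum_le_sum fun I _ => Finset.card_biUnion_le
      _ ≤ ∑ I : Finset (Fin k), ∑ L ∈ LST, (4 * (m * t) ^ 2 + 7) :=
          Finset.sum_le_sum fun I _ => Finset.sum_le_sum fun L _ =>
            Finset.card_image_le.trans (hBTcard I)
      _ = Fintype.card (Finset (Fin k)) * (LST.card * (4 * (m * t) ^ 2 + 7)) := by
          simp only [Finset.sum_const, smul_eq_mul, Finset.card_univ]
      _ ≤ 2 ^ k * ((m * t + 1) ^ k * (4 * (m * t) ^ 2 + 7)) := by
          rw [Fintype.card_finset, Fintype.card_fin]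
          exact Nat.mul_le_mul_left _ (Nat.mul_le_mul_right _ hLSTcard)
  -- every vertex is covered
  have hcover : Set.extremePoints ℝ (convexHull ℝ
      ((fun e : Fin 2 →₀ ℕ => fun i : Fin 2 => ((e i : ℕ) : ℝ)) ''
        ((∑ i, ∏ j, f i j).support : Set (Fin 2 →₀ ℕ)))) ⊆ ↑U := by
    intro p hp
    obtain ⟨a, l, ha, hpa, hTa, htop⟩ := stub_exposedWord A f hf hinj p hp
    -- alive pattern of `a` and its box
    set I : Finset (Fin k) := Finset.univ.filter fun i => ∀ j, c i j (a j) ≠ 0 with hI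
    have haC : ∀ j, a j ∈ C I j := by
      intro j
      refine Finset.mem_filter.2 ⟨ha j, fun i hi => ?_⟩
      exact (Finset.mem_filter.1 hi).2 j
    -- coordinatewise lexicographic tops of the box
    have hex : ∀ j, ∃ bj ∈ C I j, ∀ e ∈ C I j,
        (toLex (l (fun i : Fin 2 => ((e i : ℕ) : ℝ)), toLex (e 0, e 1)) : Lex (ℝ × Lex (ℕ × ℕ)))
          ≤ toLex (l (fun i : Fin 2 => ((bj i : ℕ) : ℝ)), toLex (bj 0, bj 1)) := fun j =>
      Finset.exists_max_image (C I j)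
        (fun e : Fin 2 →₀ ℕ =>
          (toLex (l (fun i : Fin 2 => ((e i : ℕ) : ℝ)), toLex (e 0, e 1)) : Lex (ℝ × Lex (ℕ × ℕ))))
        ⟨a j, haC j⟩
    choose b hbC hbmax using hex
    have hbA : ∀ j, b j ∈ A j := fun j => hCA I j (hbC j)
    have hba : ∀ j, l (fun i : Fin 2 => (((a j) i : ℕ) : ℝ)) ≤ l (fun i : Fin 2 => (((b j) i : ℕ) : ℝ)) := by
      intro j
      have h := hbmax j (a j) (haC j)
      rw [Prod.Lex.toLex_le_toLex] at h
      rcases h with h | ⟨h, _⟩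
      · exact h.le
      · exact h.le
    have hbI : ∀ i, (∀ j, c i j (a j) ≠ 0) → ∀ j, c i j (b j) ≠ 0 := by
      intro i hi j
      have hiI : i ∈ I := Finset.mem_filter.2 ⟨Finset.mem_univ _, hi⟩
      exact (Finset.mem_filter.1 (hbC j)).2 i hiI
    -- thickness (the lever)
    have hthick : (Finset.univ.filter fun j => b j ≠ a j).card < k :=
      stub_thicknessFit A c l a b ha hbA hTa htop hbI hba
    set J : Finset (Fin m) := Finset.univ.filter fun j => b j ≠ a j with hJ
    -- decoding the canonical slot list of `(J, a)` against `b` returns `a`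
    have hword : ∀ j, word (canon (k := k) J a) b j = a j := by
      intro j
      apply word_eq (a := a)
      · intro s e hs
        exact (canon_faithful hs).2
      · by_cases hj : j ∈ J
        · exact Or.inl (canon_covers hj hthick.le)
        · right
          by_contra hne
          exact hj (Finset.mem_filter.2 ⟨Finset.mem_univ _, hne⟩)
    have hsum : (∑ j, word (canon (k := k) J a) b j) = ∑ j, a j :=
      Finset.sum_congr rfl fun j _ => hword j
    -- membership in the covering finset
    rw [Finset.mem_coe]
    refine Finset.mem_biUnion.2 ⟨I, Finset.mem_univ _, ?_⟩
    refine Finset.mem_biUnion.2 ⟨canon (k := k) J a, ?_, ?_⟩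
    · exact Fintype.mem_piFinset.2 fun s => canon_mem A ha s
    · refine Finset.mem_image.2 ⟨b, ?_, ?_⟩
      · exact Finset.mem_filter.2 ⟨Fintype.mem_piFinset.2 hbC, l, fun j e he => hbmax j e he⟩
      · rw [hpa, hsum]
  -- conclude
  calc (Set.extremePoints ℝ (convexHull ℝ
          ((fun e : Fin 2 →₀ ℕ => fun i : Fin 2 => ((e i : ℕ) : ℝ)) ''
            ((∑ i, ∏ j, f i j).support : Set (Fin 2 →₀ ℕ))))).ncard
      ≤ (↑U : Set (Fin 2 → ℝ)).ncard := Set.ncard_le_ncard hcover U.finite_toSet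
    _ = U.card := Set.ncard_coe_finset U
    _ ≤ 2 ^ k * ((m * t + 1) ^ k * (4 * (m * t) ^ 2 + 7)) := hUcard
    _ ≤ (m * t + 2) ^ (2 * k + 3) := count_arith k m t

end

end Summit.ValiantsHypothesis.ValiantsHypothesis.Cruxes.DissociatedFixedK.AnnihilatorProductFunctional
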